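/-
Copyright (c) 2026 the pub-hodgecm-mathlib formalisation cell (harness21).  Prover seat hodgecm-mathlib-LH4-p07 (g7), Track A «(D-RAM) FOUR-FRAME», unit U2H, the census leaf
(ρ2b′-X) `stub_U2H_fixedPointCensus_typeTwo_unit0` — typed bottom SOCKET (B) of the payer's MAP v3 (LH4-p14): the order-count census on type RamK, composed over the
★ organs of the LH4 ∕ F0P3 squads (LH4-p05, p08, p09, p11, p12, p13, F0P3-p01 and this seat).  2026-09-04.
-/
import Summits.HodgeConjecture.HodgeConjecture.Theorems.F0P3cDyRamFixedPointCensusTypeTwoPrelude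
import Summits.HodgeConjecture.HodgeConjecture.Theorems.F0P3cDyRamBlockCensusOrderForm
import Summits.HodgeConjecture.HodgeConjecture.Theorems.F0P3cDyRamFrameRamKAtPlace                  -- ★ p858003 (LH4-p12): (B-0) `ramK_frame_at_place'`
import Summits.HodgeConjecture.HodgeConjecture.Theorems.F0P3cDyRamToricLevelCensusRamKAtThirdField   -- ★ p858020 (this seat): hFN `forall_fixed_fixed_exists_mul_theta_eq_of_frame`, rows
import Summits.HodgeConjecture.HodgeConjecture.Theorems.F0P3cDyRamTokenDepthNearOne                  -- ★ p858075 (this seat): `exists_nhds_one_le_tokenDepth`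
import Summits.HodgeConjecture.HodgeConjecture.Theorems.F0P3cDyRamToricCensusSumRamKWeld                -- ★ p858068 (F0P3-p01 (g33)): (B-2) `toricCensusSum_ramK_weld`
import Summits.HodgeConjecture.HodgeConjecture.Theorems.F0P3cDyRamToricCensusSumUnrReindex              -- ★ p857817 (LH4-p08): reindex `orderCounts_eq_censusSum_unr` (type-free)
import Summits.HodgeConjecture.HodgeConjecture.Theorems.F0P3cDyRamOrderFiltrationRange                  -- ★ (α) `isOrd_pow_iff_le`
import Summits.HodgeConjecture.HodgeConjecture.Theorems.F0P3cDyRamCensusBottomArith                      -- ★ p858013 (this seat): `census_bottom_arith_eisenstein`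
import Summits.HodgeConjecture.HodgeConjecture.Theorems.F0P3cDyRamTypeTwoAnisotropyOfFrame                 -- ★ p858030 (LH4-p11): `haniso` from the frame equation
import Summits.HodgeConjecture.HodgeConjecture.Theorems.F0P3cDyRamTypeUBottomFacts                        -- ★ (LH4-p11): `mul_map_eq_one_of_mem_unitary_one`, `map_fixed_and_mul_map_eq_one`
import Summits.HodgeConjecture.HodgeConjecture.Theorems.F0P3cDyRamTokenFrameGlueRamK                     -- ★ p857936 (LH4-p13): `v_eq_exp_neg_of_v_mul_map_eq`
import Literature.NumberTheory.Rogawski1990.FinExplicitTransferFactorInertExponent                     -- ★ `eval_finCharpolyTwo_finGammaTwo_apply_eq_quadratic`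
import Literature.NumberTheory.Automorphic.RamifiedPlaceAntiFixedUniformizer                            -- ★ `valued_toPlace_uniformizer_of_ramified`
import Summits.HodgeConjecture.HodgeConjecture.Theorems.F0P3cDyRamOrderCountCensusRamKNormaliser          -- ★ p858129 (LH4-p13): `btop_tokens_cm`
import Summits.HodgeConjecture.HodgeConjecture.Theorems.F0P3cDyRamOrderCountCensusRamKSymbol              -- ★ p858158 (LH4-p13): `btop_side_symbol_cm`
import Summits.HodgeConjecture.HodgeConjecture.Theorems.F0P3cDyRamOrderCountCellsBound                 -- ★-pending (F0P3-p01 (g34)): `hRcells_h`, `hRcells_h'`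
import Summits.HodgeConjecture.HodgeConjecture.Theorems.F0P3cDyRamTypeBSelector                        -- ★ p858321 (LH4-p05): (S-sel) `not_inertDatum_typeB_of_organ`, (S-dK) `discDepth_eq_typeB_of_organ`
import Literature.NumberTheory.Automorphic.ProjectiveDescentLatticeLevelsDischarge                     -- ★ `valued_toPlace_eq_pow_two_of_ramified`
import Summits.HodgeConjecture.HodgeConjecture.Theorems.F0P3cDyRamHSideClosedForm                       -- ★ p857701 (LH4-p09): `hSide_closedForm_of_tube_exists`
import Summits.HodgeConjecture.HodgeConjecture.Theorems.F0P3cDyRamHSideLevelLetter                       -- ★ (LH4-p09): `valued_trace_eq_of_sub_two_lt`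
import Summits.HodgeConjecture.HodgeConjecture.Theorems.F0P3cDyRamTypeTwoLevelDictionary                  -- ★ p858041 (LH4-p11): `sq_sub_map_eq_map_disc`, `condLevel_eq_of_hlev`
import Summits.HodgeConjecture.HodgeConjecture.Theorems.F0P3cDyRamRowOneRootDepth                       -- ★ `eventually_nhds_one_valued_trace_sub_two_le`
import Literature.NumberTheory.Automorphic.LocalUnitaryIntegralLevel                                   -- ★ `placeForm_antidiagOne`
import Literature.NumberTheory.Automorphic.QuadraticLocalBaseChange
import Literature.NumberTheory.Automorphic.AdicCompletionCompact                                   -- ★ `finite_residueField_adicCompletion`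
import Literature.NumberTheory.AdelicBaseChange.AdicCompletionDensity                              -- ★ instance `IsDiscreteValuationRing 𝒪[K_v]`
import HarnessLib

set_option autoImplicit false

/-!
# Socket (B): the order-count census of the (ρ2b′-X) leaf on type RamK

At a place `v` of the maximal real subfield `L⁺` of the CM field `L` that RAMIFIES in `L` (`e(w ∕ v) ≠ 1`, `w` the conjugation-stable place over it,
`σ_w` the local conjugation, `ϖ` a uniformizer of `L_w`), the census of the fixed-point leaf (ρ2b′-X) is read through an auxiliary quadratic extension
`E' ∕ L` and its place `w₁ ∣ w`; socket (B) is the bottom on which `σ_w` carries a RAMIFIED quadratic datum `IsRamifiedQuadraticDatum σ_w ϖ d tE` and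
`E'_{w₁} ∕ L_w` is of type RamK (the frame letters `|ι a| = |a|`-shape are part of the hypotheses), in residue characteristic `2` (`|2|_w < 1`).

`orderCountCensusB` produces a neighbourhood `V ∈ 𝓝 1` of the local group `H_v = U(2)_v × U(1)_v` such that, for every `G`-regular `γH ∈ V` whose `w`-block has
no `L_w`-rational eigenvalue, for every RamK frame `(E', c₁, δ, m₀, s, w₁, Θ, α, λ)` over it and every pair of order filtrations `h, h'` with their cell, level-set
and glue data (the binders of SOCKET-hOCB.v1, verbatim):
* (i) every doubly fixed unit `f₀` (`c₁`-fixed, `Θ`-fixed, `|f₀| = 1`) is a `Θ`-norm, `f₀ = z · Θ z`;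
* (ii) for every m-token `m` and every `β ∈ (L⁺_v)ˣ` reading the side symbol, the two order counts `A, A'` (toric level-set sums cut off at `J, R, R'`) satisfy
  `(q − 1) · (A − A') = (β, θ)_v · q ^ m · ((q − 1) · (#Fix(γH.1) + d % 2) − 2 · (q ^ (d − d % 2) − 1))`, `q = #𝓀(L_w)`, `(β, θ)_v` the Hilbert symbol against the
  CM generator `θ`.

## Proof — one composition over ★ organs
* `V` := «every m-token is `≥ 3d + 3tE + 2`» (★ `eventually_nhds_one_le_tokenDepth`, this seat) `∧` «`|tr γ_w − 2| ≤ |2ϖ|`» (★ `eventually_nhds_one_valued_trace_sub_two_le`).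
* (B-0) ★ `ramK_frame_at_place'` (LH4-p12): residual triviality of `σ` and `Θ`, the transported datum `IsRamifiedQuadraticDatum Θ (ι ϖ) d tE`, `|ι a| = |a|`, `#𝓀 = q²`.
* (i) ★ `forall_fixed_fixed_exists_mul_theta_eq_of_frame` (this seat; the third-field package, ★ `QuadraticDatumNormsOfDoublyFixedUnitsThirdField`).
* (ii) cells ★ `hRcells_h ∕ hRcells_h'` (F0P3-p01) → reindex ★ `orderCounts_eq_censusSum_unr_of_cells` (LH4-p08) → level range ★ `isOrd_pow_iff_le` → tokens
  ★ `btop_tokens_cm` and side symbol ★ `btop_side_symbol_cm` (LH4-p13) → anisotropy ★ `TypeTwoAnisotropyOfFrame` (LH4-p11) → WELD ★ `toricCensusSum_ramK_weld` (F0P3-p01);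
  H-side ★ `hSide_closedForm_of_tube_exists` (LH4-p09), whose INERT disjunct is impossible on type (B) (★ `not_inertDatum_typeB_of_organ`, LH4-p05), level link
  ★ `condLevel_eq_of_hlev` (LH4-p11), discriminant depth `d_K = d` (★ `discDepth_eq_typeB_of_organ`, LH4-p05 over ★ `discDepth_eq_of_eisenstein`, LH4-p12), and the
  closing arithmetic ★ `census_bottom_arith_eisenstein` (this seat).

Non-vacuity of the hypothesis package: LH4-r01 (g6) BOX IQ (`L = ℚ(√−5)`, `E' = L(√−3)`, `M = ℚ₂(√3, ζ₃)`).  HONEST LABEL: a helper toward h413 =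
stmt-HodgeConjecture-24833; HC_CM is proved only modulo the 7 printed citations (2 remaining named inputs: hLiu418 = stmt-HodgeConjecture-24832, h413 =
stmt-HodgeConjecture-24833) until rung 0 closes.
[cite: Rogawski1990, §4.9 pp. 55–56; §12.2] [cite: LabesseLanglands1979, §2 pp. 7–8] [cite: Serre1979, Ch. I §6, Ch. III §4]
-/

noncomputable section

namespace Summit.HodgeConjecture.HodgeConjecture.Cruxes.H413.F0P3cDyRamOrderCountCensusRamK

open MeasureTheory Measure NumberField IsDedekindDomain Topology Filter
open Literature.NumberTheory.Automorphic Literature.NumberTheory.Automorphic.UnitaryGroup Literature.NumberTheory.Automorphic.IntegralReduction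
open Literature.NumberTheory.Rogawski1990 Literature.NumberTheory.GaloisRepresentations
open Literature.NumberTheory.Automorphic.UnitaryThreeFourFrame
open scoped Matrix MatrixGroups Classical Valued
open Literature.NumberTheory.Automorphic.UnitaryLatticeTree Literature.NumberTheory.Automorphic.HermitianLattice
open Literature.NumberTheory.QuadraticForms
open Summit.HodgeConjecture.HodgeConjecture.Cruxes.H413.F0P3cDyRamToricCensusDefs
open Summit.HodgeConjecture.HodgeConjecture.Cruxes.H413.F0P3cDyRamFrameRamKAtPlace (ramK_frame_at_place')
open Summit.HodgeConjecture.HodgeConjecture.Cruxes.H413.F0P3cDyRamToricLevelCensusRamKAtThirdField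
open Summit.HodgeConjecture.HodgeConjecture.Cruxes.H413.F0P3cDyRamTokenDepthNearOne (exists_nhds_one_le_tokenDepth eventually_nhds_one_le_tokenDepth)
open Summit.HodgeConjecture.HodgeConjecture.Cruxes.H413.F0P3cDyRamToricLevelCensusRamK (toricCensusSum_ramK_weld)
open Summit.HodgeConjecture.HodgeConjecture.Cruxes.H413.F0P3cDyRamToricLevelCensusUnr (orderCounts_eq_censusSum_unr)
open Summit.HodgeConjecture.HodgeConjecture.Cruxes.H413.F0P3cDyRamOrderFiltrationRange (isOrd_pow_iff_le)
open Summit.HodgeConjecture.HodgeConjecture.Cruxes.H413.F0P3cDyRamCensusBottomArith (census_bottom_arith_eisenstein)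
open Summit.HodgeConjecture.HodgeConjecture.Cruxes.H413.F0P3cDyRamTypeTwoAnisotropyOfFrame
open Summit.HodgeConjecture.HodgeConjecture.Cruxes.H413.F0P3cDyRamTypeUBottomFacts (mul_map_eq_one_of_mem_unitary_one map_fixed_and_mul_map_eq_one)
open Summit.HodgeConjecture.HodgeConjecture.Cruxes.H413.F0P3cDyRamTokenFrameGlueRamK (v_eq_exp_neg_of_v_mul_map_eq)
open Summit.HodgeConjecture.HodgeConjecture.Cruxes.H413.F0P3cDyRamOrderCountCensusRamKNormaliser (btop_tokens_cm)
open Summit.HodgeConjecture.HodgeConjecture.Cruxes.H413.F0P3cDyRamOrderCountCensusRamKSymbol (btop_side_symbol_cm)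
open Summit.HodgeConjecture.HodgeConjecture.Cruxes.H413.F0P3cDyRamHSideClosedForm (hSide_closedForm_of_tube_exists)
open Summit.HodgeConjecture.HodgeConjecture.Cruxes.H413.F0P3cDyRamHSideLevelLetter (valued_trace_eq_of_sub_two_lt)
open Summit.HodgeConjecture.HodgeConjecture.Cruxes.H413.F0P3cDyRamTypeTwoLevelDictionary (sq_sub_map_eq_map_disc condLevel_eq_of_hlev)

set_option maxHeartbeats 2000000 in
-- budget only: the statement alone is ≈ 19 400 normalised characters of binders; the proof is a composition of ★ organs (no search).
/-- **SOCKET (B) — THE ORDER-COUNT CENSUS OF THE (ρ2b′-X) LEAF ON TYPE RamK** (SOCKET-hOCB.v1 verbatim, plus the residue-characteristic binder `h2v`):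
a neighbourhood `V ∈ 𝓝 (1 : H_v)` on which, for every admissible `γH` and every RamK frame with its order-filtration data, (i) doubly fixed units are `Θ`-norms and
(ii) `(q − 1)(A − A') = (β, θ)_v · q^m · ((q − 1)(#Fix(γH.1) + d % 2) − 2 (q^(d − d % 2) − 1))`.  Composition over the ★ organs listed in the module docstring.
[cite: Rogawski1990, §4.9 pp. 55–56] [cite: LabesseLanglands1979, §2 pp. 7–8] -/
theorem orderCountCensusB (L : Type) [Field L] [NumberField L] [IsCMField L]
    {v : HeightOneSpectrum (𝓞 ↥(maximalRealSubfield L))} (w : UnitaryGroup.PlacesOver L v)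
    (hw : IsCMField.complexConj L • w.1 = w.1) (he : v.asIdeal.ramificationIdx' w.1.asIdeal ≠ 1)
    (ϖ : (w.1.adicCompletion L)) (hϖ : Valued.v ϖ = WithZero.exp (-1 : ℤ)) (d tE : ℕ)
    (hD : IsRamifiedQuadraticDatum (galAdicCompletionMap (L := L) (IsCMField.complexConj L) hw) ϖ d tE)
    (h2v : Valued.v (2 : (w.1.adicCompletion L)) < 1)
    [Fintype (Valued.ResidueField (w.1.adicCompletion L))] :
      ∃ V ∈ 𝓝 (1 : ((UnitaryGroup.cmDatum L 2 (Matrix.of fun i j : Fin 2 => if i.val + j.val + 1 = 2 then (1 : L) else 0)).Local v × (UnitaryGroup.cmDatum L 1 (Matrix.of fun i j : Fin 1 => if i.val + j.val + 1 = 1 then (1 : L) else 0)).Local v)), ∀ γH ∈ V, IsLocalGRegular L v γH →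
        ¬ (∃ x : (w.1.adicCompletion L), (((((γH).1.val : GL (Fin 2) (UnitaryGroup.LocalRing L v)).val.map (Pi.evalRingHom (fun w' : UnitaryGroup.PlacesOver L v => w'.1.adicCompletion L) w))).charpoly).IsRoot x) →
        ∀ (E' : Type) [Field E'] [NumberField E'] [Algebra L E'] [Algebra.IsQuadraticExtension L E'] (c₁ : E' ≃ₐ[L] E') (δ : E') (m₀ : L)
          (s : (w.1.adicCompletion L)) (w₁ : UnitaryGroup.PlacesOver E' w.1) (hw₁ : c₁ • w₁.1 = w₁.1)
          (Θ : (w₁.1.adicCompletion E') →+* (w₁.1.adicCompletion E')) (α lam : (w₁.1.adicCompletion E')),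
          c₁ ≠ 1 → c₁ δ = -δ → δ ≠ 0 → algebraMap L E' m₀ = δ ^ 2 → s ≠ 0 →
          (((γH.1.val : GL (Fin 2) (UnitaryGroup.LocalRing L v)).val.map (Pi.evalRingHom (fun w' : UnitaryGroup.PlacesOver L v => w'.1.adicCompletion L) w))).trace * (((γH.1.val : GL (Fin 2) (UnitaryGroup.LocalRing L v)).val.map (Pi.evalRingHom (fun w' : UnitaryGroup.PlacesOver L v => w'.1.adicCompletion L) w))).trace - 4 * (((γH.1.val : GL (Fin 2) (UnitaryGroup.LocalRing L v)).val.map (Pi.evalRingHom (fun w' : UnitaryGroup.PlacesOver L v => w'.1.adicCompletion L) w))).det = s * s * ((m₀ : L) : (w.1.adicCompletion L)) →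
          (((γH.1.val : GL (Fin 2) (UnitaryGroup.LocalRing L v)).val.map (Pi.evalRingHom (fun w' : UnitaryGroup.PlacesOver L v => w'.1.adicCompletion L) w))).det * (galAdicCompletionMap (L := L) (IsCMField.complexConj L) hw) (((γH.1.val : GL (Fin 2) (UnitaryGroup.LocalRing L v)).val.map (Pi.evalRingHom (fun w' : UnitaryGroup.PlacesOver L v => w'.1.adicCompletion L) w))).det = 1 → (((γH.1.val : GL (Fin 2) (UnitaryGroup.LocalRing L v)).val.map (Pi.evalRingHom (fun w' : UnitaryGroup.PlacesOver L v => w'.1.adicCompletion L) w))).trace = (((γH.1.val : GL (Fin 2) (UnitaryGroup.LocalRing L v)).val.map (Pi.evalRingHom (fun w' : UnitaryGroup.PlacesOver L v => w'.1.adicCompletion L) w))).det * (galAdicCompletionMap (L := L) (IsCMField.complexConj L) hw) (((γH.1.val : GL (Fin 2) (UnitaryGroup.LocalRing L v)).val.map (Pi.evalRingHom (fun w' : UnitaryGroup.PlacesOver L v => w'.1.adicCompletion L) w))).trace →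
          (∀ x : (w.1.adicCompletion L), x * x - (((γH.1.val : GL (Fin 2) (UnitaryGroup.LocalRing L v)).val.map (Pi.evalRingHom (fun w' : UnitaryGroup.PlacesOver L v => w'.1.adicCompletion L) w))).trace * x + (((γH.1.val : GL (Fin 2) (UnitaryGroup.LocalRing L v)).val.map (Pi.evalRingHom (fun w' : UnitaryGroup.PlacesOver L v => w'.1.adicCompletion L) w))).det ≠ 0) →
          (∀ z, galAdicCompletionMap (L := E') c₁ hw₁ (galAdicCompletionMap (L := E') c₁ hw₁ z) = z) →
          (∀ z, Valued.v (galAdicCompletionMap (L := E') c₁ hw₁ z) = Valued.v z) →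
          (∀ a, galAdicCompletionMap (L := E') c₁ hw₁ (toPlace w.1 w₁ a) = toPlace w.1 w₁ a) →
          (∀ a, Valued.v (toPlace w.1 w₁ a) ≤ 1 ↔ Valued.v a ≤ 1) →
          (∀ z : (w₁.1.adicCompletion E'), galAdicCompletionMap (L := E') c₁ hw₁ z = z ↔ ∃ a, toPlace w.1 w₁ a = z) →
          (∀ a, Θ (toPlace w.1 w₁ a) = toPlace w.1 w₁ ((galAdicCompletionMap (L := L) (IsCMField.complexConj L) hw) a)) →
          (∀ z, Θ (Θ z) = z) →
          (∀ z, Θ (galAdicCompletionMap (L := E') c₁ hw₁ z) = galAdicCompletionMap (L := E') c₁ hw₁ (Θ z)) →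
          (∀ z, Valued.v (Θ z) = Valued.v z) →
          galAdicCompletionMap (L := E') c₁ hw₁ α ≠ α →
          Valued.v α ≤ 1 →
          (∀ z : (w₁.1.adicCompletion E'), Valued.v z ≤ 1 → Valued.v ((z - galAdicCompletionMap (L := E') c₁ hw₁ z) / (α - galAdicCompletionMap (L := E') c₁ hw₁ α)) ≤ 1) →
          2 * lam = toPlace w.1 w₁ (((γH.1.val : GL (Fin 2) (UnitaryGroup.LocalRing L v)).val.map (Pi.evalRingHom (fun w' : UnitaryGroup.PlacesOver L v => w'.1.adicCompletion L) w))).trace + toPlace w.1 w₁ s * ((δ : E') : (w₁.1.adicCompletion E')) →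
          lam * lam = toPlace w.1 w₁ (((γH.1.val : GL (Fin 2) (UnitaryGroup.LocalRing L v)).val.map (Pi.evalRingHom (fun w' : UnitaryGroup.PlacesOver L v => w'.1.adicCompletion L) w))).trace * lam - toPlace w.1 w₁ (((γH.1.val : GL (Fin 2) (UnitaryGroup.LocalRing L v)).val.map (Pi.evalRingHom (fun w' : UnitaryGroup.PlacesOver L v => w'.1.adicCompletion L) w))).det →
          galAdicCompletionMap (L := E') c₁ hw₁ lam = toPlace w.1 w₁ (((γH.1.val : GL (Fin 2) (UnitaryGroup.LocalRing L v)).val.map (Pi.evalRingHom (fun w' : UnitaryGroup.PlacesOver L v => w'.1.adicCompletion L) w))).trace - lam →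
          Θ lam * lam = 1 →
          Valued.v lam = 1 →
          (∀ z : (w₁.1.adicCompletion E'), ∃! pq : (w.1.adicCompletion L) × (w.1.adicCompletion L), z = toPlace w.1 w₁ pq.1 + toPlace w.1 w₁ pq.2 * lam) →
          Valued.v (α - (galAdicCompletionMap (L := E') c₁ hw₁) α) = 1 →
          Valued.v (α - Θ α) < 1 →
          ∀ (th ta : ((UnitaryGroup.cmDatum L 3 (Matrix.of fun i j : Fin 3 => if i.val + j.val + 1 = 3 then (1 : L) else 0)).Local v)) (P₁ : GL (Fin 3) (w.1.adicCompletion L)) (dg : Fin 2 → (w.1.adicCompletion L)) (η : (w.1.adicCompletion L)) (γ₁ : GL (Fin 2) (w.1.adicCompletion L)),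
            ((localNonsplitEquiv (IsCMField.complexConj L) (Matrix.of fun i j : Fin 3 => if i.val + j.val + 1 = 3 then (1 : L) else 0) (IsCMField.complexConj_ne_one L) w hw th : ↥(unitaryGroupOfForm (galAdicCompletionMap (L := L) (IsCMField.complexConj L) hw) (placeForm (Matrix.of fun i j : Fin 3 => if i.val + j.val + 1 = 3 then (1 : L) else 0) w.1))) : GL (Fin 3) (w.1.adicCompletion L)) = endoGL (((localNonsplitEquiv (IsCMField.complexConj L) (Matrix.of fun i j : Fin 2 => if i.val + j.val + 1 = 2 then (1 : L) else 0) (IsCMField.complexConj_ne_one L) w hw γH.1 : ↥(unitaryGroupOfForm (galAdicCompletionMap (L := L) (IsCMField.complexConj L) hw) (placeForm (Matrix.of fun i j : Fin 2 => if i.val + j.val + 1 = 2 then (1 : L) else 0) w.1))) : GL (Fin 2) (w.1.adicCompletion L)), ((localNonsplitEquiv (IsCMField.complexConj L) (Matrix.of fun i j : Fin 1 => if i.val + j.val + 1 = 1 then (1 : L) else 0) (IsCMField.complexConj_ne_one L) w hw γH.2).val : GL (Fin 1) (w.1.adicCompletion L))) →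
            ((localNonsplitEquiv (IsCMField.complexConj L) (Matrix.of fun i j : Fin 3 => if i.val + j.val + 1 = 3 then (1 : L) else 0) (IsCMField.complexConj_ne_one L) w hw ta : ↥(unitaryGroupOfForm (galAdicCompletionMap (L := L) (IsCMField.complexConj L) hw) (placeForm (Matrix.of fun i j : Fin 3 => if i.val + j.val + 1 = 3 then (1 : L) else 0) w.1))) : GL (Fin 3) (w.1.adicCompletion L)) = P₁ * endoGL (γ₁, ((localNonsplitEquiv (IsCMField.complexConj L) (Matrix.of fun i j : Fin 1 => if i.val + j.val + 1 = 1 then (1 : L) else 0) (IsCMField.complexConj_ne_one L) w hw γH.2).val : GL (Fin 1) (w.1.adicCompletion L))) * P₁⁻¹ →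
            formCongr (galAdicCompletionMap (L := L) (IsCMField.complexConj L) hw) P₁ (placeForm (Matrix.of fun i j : Fin 3 => if i.val + j.val + 1 = 3 then (1 : L) else 0) w.1) = (!![(Matrix.diagonal dg) 0 0, 0, (Matrix.diagonal dg) 0 1; 0, η, 0; (Matrix.diagonal dg) 1 0, 0, (Matrix.diagonal dg) 1 1] : Matrix (Fin 3) (Fin 3) (w.1.adicCompletion L)) →
            (∀ i, Valued.v (dg i) = 1) →
            (∀ i, (galAdicCompletionMap (L := L) (IsCMField.complexConj L) hw) (dg i) = dg i) →
            (galAdicCompletionMap (L := L) (IsCMField.complexConj L) hw) η = η →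
            Valued.v η = 1 →
            (¬ ∃ t : (w.1.adicCompletion L), t * (galAdicCompletionMap (L := L) (IsCMField.complexConj L) hw) t = η) →
            γ₁ ∈ unitaryGroupOfForm (galAdicCompletionMap (L := L) (IsCMField.complexConj L) hw) (Matrix.diagonal dg) →
            (γ₁ : Matrix (Fin 2) (Fin 2) (w.1.adicCompletion L)).charpoly = (((γH.1.val : GL (Fin 2) (UnitaryGroup.LocalRing L v)).val.map (Pi.evalRingHom (fun w' : UnitaryGroup.PlacesOver L v => w'.1.adicCompletion L) w))).charpoly →
          ∀ (φ : (Fin 2 → (w.1.adicCompletion L)) →+ (w₁.1.adicCompletion E')) (h : (w₁.1.adicCompletion E')) (φ' : (Fin 2 → (w.1.adicCompletion L)) →+ (w₁.1.adicCompletion E')) (h' : (w₁.1.adicCompletion E')),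
            (∀ (c : (w.1.adicCompletion L)) (x : Fin 2 → (w.1.adicCompletion L)), φ (c • x) = toPlace w.1 w₁ c * φ x) →
            Function.Injective φ →
            Function.Surjective φ →
            (∀ x, φ ((((localNonsplitEquiv (IsCMField.complexConj L) (Matrix.of fun i j : Fin 2 => if i.val + j.val + 1 = 2 then (1 : L) else 0) (IsCMField.complexConj_ne_one L) w hw γH.1 : ↥(unitaryGroupOfForm (galAdicCompletionMap (L := L) (IsCMField.complexConj L) hw) (placeForm (Matrix.of fun i j : Fin 2 => if i.val + j.val + 1 = 2 then (1 : L) else 0) w.1))) : GL (Fin 2) (w.1.adicCompletion L)) : Matrix (Fin 2) (Fin 2) (w.1.adicCompletion L)).mulVec x) = lam * φ x) →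
            (∀ x y, toPlace w.1 w₁ (pairing (galAdicCompletionMap (L := L) (IsCMField.complexConj L) hw) (placeForm (Matrix.of fun i j : Fin 2 => if i.val + j.val + 1 = 2 then (1 : L) else 0) w.1) x y) = h * Θ (φ x) * φ y + galAdicCompletionMap (L := E') c₁ hw₁ (h * Θ (φ x) * φ y)) →
            Θ h = h →
            h ≠ 0 →
            (∃ x : (w₁.1.adicCompletion E'), x ≠ 0 ∧ h * Θ x * x + galAdicCompletionMap (L := E') c₁ hw₁ (h * Θ x * x) = 0) →
            (∀ (c : (w.1.adicCompletion L)) (x : Fin 2 → (w.1.adicCompletion L)), φ' (c • x) = toPlace w.1 w₁ c * φ' x) →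
            Function.Injective φ' →
            Function.Surjective φ' →
            (∀ x, φ' ((γ₁ : Matrix (Fin 2) (Fin 2) (w.1.adicCompletion L)).mulVec x) = lam * φ' x) →
            (∀ x y, toPlace w.1 w₁ (pairing (galAdicCompletionMap (L := L) (IsCMField.complexConj L) hw) (Matrix.diagonal dg) x y) = h' * Θ (φ' x) * φ' y + galAdicCompletionMap (L := E') c₁ hw₁ (h' * Θ (φ' x) * φ' y)) →
            Θ h' = h' →
            h' ≠ 0 →
            (∀ (t : (w.1.adicCompletion L)) (n : ℤ), Valued.v (toPlace w.1 w₁ t) = Valued.v (toPlace w.1 w₁ ϖ) ^ n ↔ Valued.v t = Valued.v ϖ ^ n) →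
            (∀ c : (w₁.1.adicCompletion E'), galAdicCompletionMap (L := E') c₁ hw₁ c = c → c ≠ 0 → Valued.v c ≤ 1 → ∃ n : ℕ, Valued.v c = Valued.v (toPlace w.1 w₁ ϖ) ^ n) →
            (∀ t : (w₁.1.adicCompletion E'), galAdicCompletionMap (L := E') c₁ hw₁ t = t → Valued.v t < 1 → Valued.v t ≤ Valued.v (toPlace w.1 w₁ ϖ)) →
              ∀ (J R R' : ℕ) (f f' : ℕ → ℕ → AddSubgroup (w₁.1.adicCompletion E') → ℕ),
              {M₃ : Submodule (Valued.integer (w.1.adicCompletion L)) (Fin 3 → (w.1.adicCompletion L)) | IsVertexLattice (galAdicCompletionMap (L := L) (IsCMField.complexConj L) hw) ϖ ((StdForm.antidiagonal 3).over (w.1.adicCompletion L)) 0 M₃ ∧ mapGL (endoGL (((localNonsplitEquiv (IsCMField.complexConj L) (Matrix.of fun i j : Fin 2 => if i.val + j.val + 1 = 2 then (1 : L) else 0) (IsCMField.complexConj_ne_one L) w hw γH.1 : ↥(unitaryGroupOfForm (galAdicCompletionMap (L := L) (IsCMField.complexConj L) hw) (placeForm (Matrix.of fun i j : Fin 2 =>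 if i.val + j.val + 1 = 2 then (1 : L) else 0) w.1))) : GL (Fin 2) (w.1.adicCompletion L)), ((localNonsplitEquiv (IsCMField.complexConj L) (Matrix.of fun i j : Fin 1 => if i.val + j.val + 1 = 1 then (1 : L) else 0) (IsCMField.complexConj_ne_one L) w hw γH.2).val : GL (Fin 1) (w.1.adicCompletion L)))) M₃ = M₃}.Finite →
              (∀ M₃ : Submodule (Valued.integer (w.1.adicCompletion L)) (Fin 3 → (w.1.adicCompletion L)), IsVertexLattice (galAdicCompletionMap (L := L) (IsCMField.complexConj L) hw) ϖ ((StdForm.antidiagonal 3).over (w.1.adicCompletion L)) 0 M₃ → mapGL (endoGL (((localNonsplitEquiv (IsCMField.complexConj L) (Matrix.of fun i j : Fin 2 => if i.val + j.val + 1 = 2 then (1 : L) else 0) (IsCMField.complexConj_ne_one L) w hw γH.1 : ↥(unitaryGroupOfForm (galAdicCompletionMap (L := L) (IsCMField.complexConj L) hw) (placeForm (Matrix.of fun i j : Fin 2 => if i.val + j.val + 1 = 2 then (1 : L) else 0) w.1))) : GL (Fin 2) (w.1.adicCompletion L)), ((localNonsplitEquiv (IsCMField.complexConj L) (Matrix.of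 fun i j : Fin 1 => if i.val + j.val + 1 = 1 then (1 : L) else 0) (IsCMField.complexConj_ne_one L) w hw γH.2).val : GL (Fin 1) (w.1.adicCompletion L)))) M₃ = M₃ →
                ∀ b : ℕ, (∀ c : (w.1.adicCompletion L), (Pi.single 1 c : Fin 3 → (w.1.adicCompletion L)) ∈ M₃ ↔ Valued.v c ≤ Valued.v ϖ ^ b) → b ≤ R) →
              {M₃ : Submodule (Valued.integer (w.1.adicCompletion L)) (Fin 3 → (w.1.adicCompletion L)) | IsSelfDualLattice (galAdicCompletionMap (L := L) (IsCMField.complexConj L) hw) ϖ (!![(Matrix.diagonal dg) 0 0, 0, (Matrix.diagonal dg) 0 1; 0, η, 0; (Matrix.diagonal dg) 1 0, 0, (Matrix.diagonal dg) 1 1] : Matrix (Fin 3) (Fin 3) (w.1.adicCompletion L)) M₃ ∧ mapGL (endoGL (γ₁, ((localNonsplitEquiv (IsCMField.complexConj L) (Matrix.of fun i j : Fin 1 => if i.val + j.val + 1 = 1 then (1 : L) else 0) (IsCMField.complexConj_ne_one L) w hw γH.2).val : GL (Fin 1) (w.1.adicCompletion L)))) M₃ = M₃}.Finite →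
              (∀ M₃ : Submodule (Valued.integer (w.1.adicCompletion L)) (Fin 3 → (w.1.adicCompletion L)), IsSelfDualLattice (galAdicCompletionMap (L := L) (IsCMField.complexConj L) hw) ϖ (!![(Matrix.diagonal dg) 0 0, 0, (Matrix.diagonal dg) 0 1; 0, η, 0; (Matrix.diagonal dg) 1 0, 0, (Matrix.diagonal dg) 1 1] : Matrix (Fin 3) (Fin 3) (w.1.adicCompletion L)) M₃ → mapGL (endoGL (γ₁, ((localNonsplitEquiv (IsCMField.complexConj L) (Matrix.of fun i j : Fin 1 => if i.val + j.val + 1 = 1 then (1 : L) else 0) (IsCMField.complexConj_ne_one L) w hw γH.2).val : GL (Fin 1) (w.1.adicCompletion L)))) M₃ = M₃ →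
                ∀ b : ℕ, (∀ c : (w.1.adicCompletion L), (Pi.single 1 c : Fin 3 → (w.1.adicCompletion L)) ∈ M₃ ↔ Valued.v c ≤ Valued.v ϖ ^ b) → b ≤ R') →
              ¬ IsOrd (galAdicCompletionMap (L := E') c₁ hw₁) α (toPlace w.1 w₁ ϖ ^ (J + 1)) lam →
              (∀ j a, (levelSet (galAdicCompletionMap (L := E') c₁ hw₁) Θ α (toPlace w.1 w₁ ϖ) h j a).Finite) →
              (∀ j a, (levelSet (galAdicCompletionMap (L := E') c₁ hw₁) Θ α (toPlace w.1 w₁ ϖ) h' j a).Finite) →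
              Valued.v ((((localNonsplitEquiv (IsCMField.complexConj L) (Matrix.of fun i j : Fin 1 => if i.val + j.val + 1 = 1 then (1 : L) else 0) (IsCMField.complexConj_ne_one L) w hw γH.2).val : GL (Fin 1) (w.1.adicCompletion L)) : Matrix (Fin 1) (Fin 1) (w.1.adicCompletion L)) 0 0) = 1 →
              (∀ (b j : ℕ) (Λ : AddSubgroup (w₁.1.adicCompletion E')) (x₀ : (w₁.1.adicCompletion E')) (r : (w.1.adicCompletion L)), 1 ≤ b → x₀ ≠ 0 →
                (∀ x, x ∈ Λ ↔ ∃ z, IsOrd (galAdicCompletionMap (L := E') c₁ hw₁) α (toPlace w.1 w₁ ϖ ^ j) z ∧ x = x₀ * z) →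
                IsOrd (galAdicCompletionMap (L := E') c₁ hw₁) α (toPlace w.1 w₁ ϖ ^ j) (dualGen (galAdicCompletionMap (L := E') c₁ hw₁) Θ α (toPlace w.1 w₁ ϖ ^ j) h x₀) → ¬ IsOrd (galAdicCompletionMap (L := E') c₁ hw₁) α (toPlace w.1 w₁ ϖ ^ j) (dualGen (galAdicCompletionMap (L := E') c₁ hw₁) Θ α (toPlace w.1 w₁ ϖ ^ j) h x₀ / toPlace w.1 w₁ ϖ) →
                Valued.v (dualGen (galAdicCompletionMap (L := E') c₁ hw₁) Θ α (toPlace w.1 w₁ ϖ ^ j) h x₀) = Valued.v (toPlace w.1 w₁ ϖ) ^ b →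
                (∀ b', (∀ x ∈ Λ, Valued.v (h * Θ x * b' + galAdicCompletionMap (L := E') c₁ hw₁ (h * Θ x * b')) ≤ 1) → (lam - toPlace w.1 w₁ ((((localNonsplitEquiv (IsCMField.complexConj L) (Matrix.of fun i j : Fin 1 => if i.val + j.val + 1 = 1 then (1 : L) else 0) (IsCMField.complexConj_ne_one L) w hw γH.2).val : GL (Fin 1) (w.1.adicCompletion L)) : Matrix (Fin 1) (Fin 1) (w.1.adicCompletion L)) 0 0)) * b' ∈ Λ) →
                IsOrd (galAdicCompletionMap (L := E') c₁ hw₁) α (toPlace w.1 w₁ ϖ ^ j) lam → toPlace w.1 w₁ r = glueUnit (galAdicCompletionMap (L := E') c₁ hw₁) Θ α (toPlace w.1 w₁ ϖ ^ j) h (toPlace w.1 w₁ ϖ) (toPlace w.1 w₁ 1) x₀ b →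
                f b j Λ = Nat.card {x : 𝒪[(w.1.adicCompletion L)] ⧸ 𝓂[(w.1.adicCompletion L)] ^ (2 * b) // ∃ u' : 𝒪[(w.1.adicCompletion L)], Ideal.Quotient.mk (𝓂[(w.1.adicCompletion L)] ^ (2 * b)) u' = x ∧
                  Valued.v ((u' : (w.1.adicCompletion L)) * (galAdicCompletionMap (L := L) (IsCMField.complexConj L) hw) u' - r) ≤ Valued.v (ϖ ^ (2 * b))}) →
              (∀ (b j : ℕ) (Λ : AddSubgroup (w₁.1.adicCompletion E')) (x₀ : (w₁.1.adicCompletion E')) (r : (w.1.adicCompletion L)), 1 ≤ b → x₀ ≠ 0 →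
                (∀ x, x ∈ Λ ↔ ∃ z, IsOrd (galAdicCompletionMap (L := E') c₁ hw₁) α (toPlace w.1 w₁ ϖ ^ j) z ∧ x = x₀ * z) →
                IsOrd (galAdicCompletionMap (L := E') c₁ hw₁) α (toPlace w.1 w₁ ϖ ^ j) (dualGen (galAdicCompletionMap (L := E') c₁ hw₁) Θ α (toPlace w.1 w₁ ϖ ^ j) h' x₀) → ¬ IsOrd (galAdicCompletionMap (L := E') c₁ hw₁) α (toPlace w.1 w₁ ϖ ^ j) (dualGen (galAdicCompletionMap (L := E') c₁ hw₁) Θ α (toPlace w.1 w₁ ϖ ^ j) h' x₀ / toPlace w.1 w₁ ϖ) →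
                Valued.v (dualGen (galAdicCompletionMap (L := E') c₁ hw₁) Θ α (toPlace w.1 w₁ ϖ ^ j) h' x₀) = Valued.v (toPlace w.1 w₁ ϖ) ^ b →
                (∀ b', (∀ x ∈ Λ, Valued.v (h' * Θ x * b' + galAdicCompletionMap (L := E') c₁ hw₁ (h' * Θ x * b')) ≤ 1) → (lam - toPlace w.1 w₁ ((((localNonsplitEquiv (IsCMField.complexConj L) (Matrix.of fun i j : Fin 1 => if i.val + j.val + 1 = 1 then (1 : L) else 0) (IsCMField.complexConj_ne_one L) w hw γH.2).val : GL (Fin 1) (w.1.adicCompletion L)) : Matrix (Fin 1) (Fin 1) (w.1.adicCompletion L)) 0 0)) * b' ∈ Λ) →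
                IsOrd (galAdicCompletionMap (L := E') c₁ hw₁) α (toPlace w.1 w₁ ϖ ^ j) lam → toPlace w.1 w₁ r = glueUnit (galAdicCompletionMap (L := E') c₁ hw₁) Θ α (toPlace w.1 w₁ ϖ ^ j) h' (toPlace w.1 w₁ ϖ) (toPlace w.1 w₁ η) x₀ b →
                f' b j Λ = Nat.card {x : 𝒪[(w.1.adicCompletion L)] ⧸ 𝓂[(w.1.adicCompletion L)] ^ (2 * b) // ∃ u' : 𝒪[(w.1.adicCompletion L)], Ideal.Quotient.mk (𝓂[(w.1.adicCompletion L)] ^ (2 * b)) u' = x ∧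
                  Valued.v ((u' : (w.1.adicCompletion L)) * (galAdicCompletionMap (L := L) (IsCMField.complexConj L) hw) u' - r) ≤ Valued.v (ϖ ^ (2 * b))}) →
            (∀ f₀ : (w₁.1.adicCompletion E'), galAdicCompletionMap (L := E') c₁ hw₁ f₀ = f₀ → Θ f₀ = f₀ → Valued.v f₀ = 1 → ∃ z : (w₁.1.adicCompletion E'), z * Θ z = f₀) ∧
            (∀ (m : ℕ) (β : (v.adicCompletion ↥(maximalRealSubfield L))ˣ), Valued.v (((finCharpolyTwo L v γH).eval (finGammaTwo L v γH)) w) = Valued.v ((toPlace v w (HeckeCharacter.uniformizer ↥(maximalRealSubfield L) v : v.adicCompletion ↥(maximalRealSubfield L))) ^ m) →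
              toPlace v w (β : (v.adicCompletion ↥(maximalRealSubfield L))) = -(((finCharpolyTwo L v γH).eval (finGammaTwo L v γH)) w * (finGammaTwo L v γH w ^ 2 + ((γH.1.val.val : Matrix (Fin 2) (Fin 2) (UnitaryGroup.LocalRing L v)).map (Pi.evalRingHom (fun w' : UnitaryGroup.PlacesOver L v => w'.1.adicCompletion L) w)).det)) / (2 * finGammaTwo L v γH w ^ 2 * ((γH.1.val.val : Matrix (Fin 2) (Fin 2) (UnitaryGroup.LocalRing L v)).map (Pi.evalRingHom (fun w' : UnitaryGroup.PlacesOver L v => w'.1.adicCompletion L) w)).det) →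
              (((Fintype.card (Valued.ResidueField (w.1.adicCompletion L))) : ℤ) - 1) * ((((∑ j ∈ Finset.range (J + 1), (if IsOrd (galAdicCompletionMap (L := E') c₁ hw₁) α (toPlace w.1 w₁ ϖ ^ j) lam then (levelSet (galAdicCompletionMap (L := E') c₁ hw₁) Θ α (toPlace w.1 w₁ ϖ) h j 0).ncard else 0)) + ∑ b ∈ Finset.Icc 1 R, ∑ j ∈ Finset.range (J + 1), (if IsOrd (galAdicCompletionMap (L := E') c₁ hw₁) α (toPlace w.1 w₁ ϖ ^ j) lam then Nat.card 𝓀[(w.1.adicCompletion L)] ^ b * (levelSetDep (galAdicCompletionMap (L := E') c₁ hw₁) Θ α (toPlace w.1 w₁ ϖ) h j b (lam - toPlace w.1 w₁ ((((localNonsplitEquiv (IsCMField.complexConj L) (Matrix.of fun i j : Fin 1 => if i.val + j.val + 1 = 1 then (1 : L) else 0) (IsCMField.complexConj_ne_one L) w hw γH.2).val : GL (Fin 1) (w.1.adicCompletion L)) : Matrix (Fin 1) (Fin 1) (w.1.adicCompletion L)) 0 0))).ncard else 0) : ℕ) : ℤ) - (((∑ j ∈ Finset.range (J + 1), (if IsOrd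 (galAdicCompletionMap (L := E') c₁ hw₁) α (toPlace w.1 w₁ ϖ ^ j) lam then (levelSet (galAdicCompletionMap (L := E') c₁ hw₁) Θ α (toPlace w.1 w₁ ϖ) h' j 0).ncard else 0)) + ∑ b ∈ Finset.Icc 1 R', ∑ j ∈ Finset.range (J + 1), (if IsOrd (galAdicCompletionMap (L := E') c₁ hw₁) α (toPlace w.1 w₁ ϖ ^ j) lam then Nat.card 𝓀[(w.1.adicCompletion L)] ^ b * (levelSetDep (galAdicCompletionMap (L := E') c₁ hw₁) Θ α (toPlace w.1 w₁ ϖ) h' j b (lam - toPlace w.1 w₁ ((((localNonsplitEquiv (IsCMField.complexConj L) (Matrix.of fun i j : Fin 1 => if i.val + j.val + 1 = 1 then (1 : L) else 0) (IsCMField.complexConj_ne_one L) w hw γH.2).val : GL (Fin 1) (w.1.adicCompletion L)) : Matrix (Fin 1) (Fin 1) (w.1.adicCompletion L)) 0 0))).ncard else 0) : ℕ) : ℤ)) = (Literature.NumberTheory.QuadraticForms.hilbertSymbol (v.adicCompletion ↥(maximalRealSubfield L)) (β : (v.adicCompletion ↥(maximalRealSubfield L))) (algebraMap ↥(maximalRealSubfield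 L) _ ((cmQuadraticGenerator L : 𝓞 ↥(maximalRealSubfield L)) : ↥(maximalRealSubfield L))) : ℤ) * ((Fintype.card (Valued.ResidueField (w.1.adicCompletion L))) : ℤ) ^ m * ((((Fintype.card (Valued.ResidueField (w.1.adicCompletion L))) : ℤ) - 1) * (((Nat.card (MulAction.fixedBy (((UnitaryGroup.cmDatum L 2 (Matrix.of fun i j : Fin 2 => if i.val + j.val + 1 = 2 then (1 : L) else 0)).Local v) ⧸ cmLocalIntegralLevel L 2 (Matrix.of fun i j : Fin 2 => if i.val + j.val + 1 = 2 then (1 : L) else 0) v) γH.1)) + d % 2 : ℕ) : ℤ) - 2 * (((Fintype.card (Valued.ResidueField (w.1.adicCompletion L))) : ℤ) ^ (d - d % 2) - 1))) := by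
  classical
  have hc1 : IsCMField.complexConj L ≠ 1 := IsCMField.complexConj_ne_one L
  have hϖ0 : ϖ ≠ 0 := fun h0 => by rw [h0, map_zero] at hϖ; exact WithZero.zero_ne_coe hϖ
  have h20 : (2 : w.1.adicCompletion L) ≠ 0 := two_ne_zero_adicCompletion L v w
  have hc20 : (2 : w.1.adicCompletion L) * ϖ ≠ 0 := mul_ne_zero h20 hϖ0
  -- the bottom prover's `V`: every m-token is `≥ 3d + 3tE + 2` (★ p858075) and `|tr g_w − 2| ≤ |2ϖ|`
  obtain ⟨V, hV, hVall⟩ := ((eventually_nhds_one_le_tokenDepth L v w (3 * d + 3 * tE + 2)).and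
    (F0P3cDyRamRowOneRootDepth.eventually_nhds_one_valued_trace_sub_two_le L v w hc20)).exists_mem
  refine ⟨V, hV, fun γH hγ hreg hirr E' _ _ _ _ c₁ δ m₀ s w₁ hw₁ Θ α lam hc₁1 hc₁δ hδ0 hmδ hs hΔ hDσ htσ hirr'
    hρρ hvρ hρj hjle1 hjfix hΘj hΘΘ hΘρ hvΘ hρα hα1 hint h2lam hlam2 hρlam hΘlam hvlam huniq hα hram => ?_⟩
  intro th ta P₁ dg η γ₁ hth hta hform hdg1 hdgσ hησ hη1 hηN hγ₁U hγ₁χ φ h φ' h' hφc hφi hφs hφγ hφH hΘh hh hhyper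
    hφ'c hφ'i hφ's hφ'γ hφ'H hΘh' hh' hjpow hfixpow hsmall J R R' f f' hfinV hRV hfinS hRS hJ hfinLS hfinLS' hu1 hf hf'
  -- (B-0) the one-field RamK frame at the place (LH4-p12 (g5) ★ `ramK_frame_at_place'`)
  haveI : Finite 𝓀[w₁.1.adicCompletion E'] := finite_residueField_adicCompletion E' w₁.1
  obtain ⟨hσres, hΘres, hΘne, hDΘ, hjv1, hqM⟩ :=
    ramK_frame_at_place' L w hw E' c₁ w₁ hw₁ hc₁1 he hD Θ hρρ hvρ hjle1 hjfix hΘj hΘΘ hvΘ hα1 hα hram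
  refine ⟨forall_fixed_fixed_exists_mul_theta_eq_of_frame hρρ hvρ hΘρ hα1 hα hDΘ hqM hσres hram, ?_⟩
  -- the census identity
  intro m β hmtok hβ
  obtain ⟨hVm, hVtr⟩ := hVall γH hγ
  have hm0 : 3 * d + 3 * tE + 2 ≤ m := hVm m hmtok
  -- abbreviations: `ρ' = c₁` on `M`, `ιw = ι_{w₁}`, the `U(1)`-token `u₀`
  set ρ' : (w₁.1.adicCompletion E') →+* (w₁.1.adicCompletion E') := galAdicCompletionMap (L := E') c₁ hw₁ with hρ'def
  set ιw : (w.1.adicCompletion L) →+* (w₁.1.adicCompletion E') := toPlace w.1 w₁ with hιwdef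
  set u₀ : (w.1.adicCompletion L) := (((localNonsplitEquiv (IsCMField.complexConj L) (Matrix.of fun i j : Fin 1 => if i.val + j.val + 1 = 1 then (1 : L) else 0)
      (IsCMField.complexConj_ne_one L) w hw γH.2).val : GL (Fin 1) (w.1.adicCompletion L)) : Matrix (Fin 1) (Fin 1) (w.1.adicCompletion L)) 0 0 with hu₀def
  set qw : ℕ := Nat.card 𝓀[w.1.adicCompletion L] with hqwdef
  have hqw : qw = Fintype.card (Valued.ResidueField (w.1.adicCompletion L)) := Nat.card_eq_fintype_card
  -- datum letters at `M`
  have hϖE : Valued.v (ιw ϖ) = WithZero.exp (-1 : ℤ) := by rw [hjv1, hϖ]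
  have hϖE0 : ιw ϖ ≠ 0 := fun h0 => by rw [h0, map_zero] at hϖE; exact WithZero.zero_ne_coe hϖE
  have hϖE1 : Valued.v (ιw ϖ) < 1 := by rw [hϖE, ← WithZero.exp_zero, WithZero.exp_lt_exp]; norm_num
  have hρϖ : ρ' (ιw ϖ) = ιw ϖ := hρj ϖ
  have hqM2 : Nat.card 𝓀[w₁.1.adicCompletion E'] = qw ^ 2 := hqM
  -- the `U(1)`-token `u := ιw u₀`
  have hΦ1 : IsUnit ((placeForm (Matrix.of fun i j : Fin 1 => if i.val + j.val + 1 = 1 then (1 : L) else 0) w.1) 0 0) := by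
    rw [placeForm_antidiagOne]
    simp [StdForm.over, StdForm.antidiagonal]
  have hu₀1 : (galAdicCompletionMap (L := L) (IsCMField.complexConj L) hw) u₀ * u₀ = 1 :=
    mul_map_eq_one_of_mem_unitary_one (galAdicCompletionMap (L := L) (IsCMField.complexConj L) hw) hΦ1
      (localNonsplitEquiv (IsCMField.complexConj L) (Matrix.of fun i j : Fin 1 => if i.val + j.val + 1 = 1 then (1 : L) else 0)
        (IsCMField.complexConj_ne_one L) w hw γH.2).2
  obtain ⟨hu, hu1'⟩ := map_fixed_and_mul_map_eq_one (galAdicCompletionMap (L := L) (IsCMField.complexConj L) hw) ιw hΘj hjfix hu₀1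
  -- `jl := −log |lam − ρ lam|`
  obtain ⟨jl, hjlv⟩ : ∃ jl : ℕ, Valued.v (lam - ρ' lam) = WithZero.exp (-(jl : ℤ)) := by
    have h0 : lam - ρ' lam ≠ 0 := by
      have hδM : ((δ : E') : w₁.1.adicCompletion E') ≠ 0 := by
        refine (Valuation.ne_zero_iff (Valued.v)).1 ?_
        rw [IsDedekindDomain.HeightOneSpectrum.valuedAdicCompletion_eq_valuation']
        exact (Valuation.ne_zero_iff _).2 hδ0
      have heq : lam - ρ' lam = ιw s * ((δ : E') : w₁.1.adicCompletion E') := by rw [hρlam]; linear_combination h2lam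
      rw [heq]; exact mul_ne_zero ((map_ne_zero ιw).2 hs) hδM
    have h1 : Valued.v (lam - ρ' lam) ≤ 1 := (Valuation.map_sub _ _ _).trans (max_le hvlam.le (by rw [hvρ]; exact hvlam.le))
    have hv0 : Valued.v (lam - ρ' lam) ≠ 0 := (Valuation.ne_zero_iff _).2 h0
    obtain ⟨k, hk⟩ : ∃ k : ℤ, Valued.v (lam - ρ' lam) = WithZero.exp k := ⟨_, (WithZero.exp_log hv0).symm⟩
    have hk0 : k ≤ 0 := by rw [hk, ← WithZero.exp_zero, WithZero.exp_le_exp] at h1; exact h1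
    exact ⟨(-k).toNat, by rw [hk, Int.toNat_of_nonneg (by omega), neg_neg]⟩
  have hjl : Valued.v ((lam - ιw u₀) - ρ' (lam - ιw u₀)) = WithZero.exp (-(jl : ℤ)) := by
    rw [ρ'.map_sub, hu, sub_sub_sub_cancel_right, hjlv]
  -- the m-token read on `M`: `|lam − u| = exp(−m)`
  have hm : Valued.v (lam - ιw u₀) = WithZero.exp (-(m : ℤ)) := by
    -- `u₀ = u_w` (★ `coe_coe_localNonsplitEquiv_apply` is `rfl`), `χ_g(u)_w = u_w² − tr·u_w + det` (★), read in `M`: `= (u − lam)·ρ'(u − lam)`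
    have hu₀γ : u₀ = finGammaTwo L v γH w := rfl
    have hNρ : ιw (((finCharpolyTwo L v γH).eval (finGammaTwo L v γH)) w) = (lam - ιw u₀) * ρ' (lam - ιw u₀) := by
      rw [eval_finCharpolyTwo_finGammaTwo_apply_eq_quadratic L v w γH, ← hu₀γ, map_add, map_sub, map_pow, map_mul, ρ'.map_sub, hu, hρlam]
      linear_combination hlam2
    have hv2 : Valued.v ((lam - ιw u₀) * ρ' (lam - ιw u₀)) = WithZero.exp (-(2 * (m : ℤ))) := by
      rw [← hNρ, hjv1, hmtok, map_pow, (valued_toPlace_uniformizer_of_ramified L (IsCMField.complexConj L) hc1 w hw he).1,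
        ← WithZero.exp_nsmul, nsmul_eq_mul]
      congr 1; ring
    exact v_eq_exp_neg_of_v_mul_map_eq hvρ hv2
  -- the order filtration of `lam`: `lam ∈ 𝒪_j ↔ j ≤ jl`, hence `jl ≤ J`
  have hiff : ∀ j, IsOrd ρ' α (ιw ϖ ^ j) lam ↔ j ≤ jl := fun j =>
    isOrd_pow_iff_le hρα hϖE0 hϖE1 hvlam.le (by rw [hjlv, hα, mul_one, hϖE, ← WithZero.exp_nsmul, nsmul_eq_mul, mul_neg, mul_one]) j
  have hJle : jl ≤ J := by
    have h := hJ; rw [hiff] at h; omega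
  -- (B-3) the depth cut-offs `R`, `R'` bound every non-empty cell (★ F0P3-p01 (g34) `hRcells_h∕h'` over ★ GAP-R p858039), then reindex (★ p858032)
  have hFN' := forall_fixed_fixed_exists_mul_theta_eq_of_frame hρρ hvρ hΘρ hα1 hα hDΘ hqM hσres hram
  have hRcells := F0P3cDyRamOrderCountCellsBound.hRcells_h L w hw hϖ hD h2v ιw hρρ hvρ hjle1 hjfix hΘj hΘΘ hΘρ hvΘ hρα hα1 hint hvlam hth φ
    hφc hφi hφs hφγ hφH hΘh hh hjpow hsmall hRV hu1 hFN'
  have hRcells' := F0P3cDyRamOrderCountCellsBound.hRcells_h' L w hw hϖ hD h2v ιw hρρ hvρ hjle1 hjfix hΘj hΘΘ hΘρ hvΘ hρα hα1 hint hvlam hta hform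
    hdg1 hdgσ hησ hη1 φ' hφ'c hφ'i hφ's hφ'γ hφ'H hΘh' hh' hjpow hsmall hRS hu1 hFN'
  have hA := F0P3cDyRamToricLevelCensusUnr.orderCounts_eq_censusSum_unr_of_cells hρρ hvρ hΘΘ hΘρ hvΘ hα1 hα hρϖ hϖE hh hm hjl qw hiff hJle hRcells
  have hA' := F0P3cDyRamToricLevelCensusUnr.orderCounts_eq_censusSum_unr_of_cells hρρ hvρ hΘΘ hΘρ hvΘ hα1 hα hρϖ hϖE hh' hm hjl qw hiff hJle hRcells'
  -- (B-top) the token facts (★ p858129, LH4-p13 (g6))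
  obtain ⟨hd2, hjlS, hmpar, hmS⟩ := btop_tokens_cm L w hw ϖ d tE hD h2v ιw hjv1 ρ' Θ hρρ hvρ hΘρ hjfix hΘj hDΘ hα1 hα hram
    hΘlam hlam2 hρlam hirr' hDσ hu₀1 hm hjl (by omega)
  -- (S9-R) the sign `ε := (β, θ)_v` and the far-cell side (LH4-p13 (g6) F2 ∕ PART III)
  set ε : ℤ := hilbertSymbol (v.adicCompletion ↥(maximalRealSubfield L)) (β : (v.adicCompletion ↥(maximalRealSubfield L)))
      (algebraMap ↥(maximalRealSubfield L) _ ((cmQuadraticGenerator L : 𝓞 ↥(maximalRealSubfield L)) : ↥(maximalRealSubfield L))) with hεdef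
  have hε : ε = 1 ∨ ε = -1 := hilbertSymbol_eq_one_or_eq_neg_one _ _
  have hεQ : (ε : ℚ) = 1 ∨ (ε : ℚ) = -1 := by rcases hε with h | h <;> simp [h]
  -- (S9-R) the far-cell side ↔ `(β, θ)_v = 1` (★ p858158, LH4-p13 (g6) PART III)
  have hχ : ((finCharpolyTwo L v γH).eval (finGammaTwo L v γH)) w =
      u₀ ^ 2 - (((γH.1.val : GL (Fin 2) (UnitaryGroup.LocalRing L v)).val.map
        (Pi.evalRingHom (fun w' : UnitaryGroup.PlacesOver L v => w'.1.adicCompletion L) w))).trace * u₀ +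
        (((γH.1.val : GL (Fin 2) (UnitaryGroup.LocalRing L v)).val.map
          (Pi.evalRingHom (fun w' : UnitaryGroup.PlacesOver L v => w'.1.adicCompletion L) w))).det :=
    eval_finCharpolyTwo_finGammaTwo_apply_eq_quadratic L v w γH
  have hside := btop_side_symbol_cm L w hw ϖ d tE hD h2v ιw hjv1 ρ' Θ hρρ hvρ hΘρ hjfix hΘj hDΘ hα1 hα hram hΘh hh hhyper
    hΘlam hlam2 hρlam hirr' hDσ hu₀1 (jl := jl) hm (by omega) (β : v.adicCompletion ↥(maximalRealSubfield L)) hχ hβ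
  -- the anisotropic line model: `h'` is anisotropic (★ p858030, LH4-p11: determinants + `η ∉ N(L_wˣ)`)
  have hplane : ¬ ∃ x : Fin 2 → (w.1.adicCompletion L), x ≠ 0 ∧
      pairing (galAdicCompletionMap (L := L) (IsCMField.complexConj L) hw) (Matrix.diagonal dg) x x = 0 :=
    not_exists_pairing_diagonal_self_eq_zero_of_formCongr (galAdicCompletionMap (L := L) (IsCMField.complexConj L) hw) P₁ dg η
      (by rw [← placeForm_antidiagOne]; exact hform) hdgσ
      (fun i h0 => by have h1 := hdg1 i; rw [h0, map_zero] at h1; exact zero_ne_one h1) hηN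
  have haniso : ¬ ∃ z : (w₁.1.adicCompletion E'), z ≠ 0 ∧ h' * Θ z * z + ρ' (h' * Θ z * z) = 0 :=
    not_exists_herm_self_eq_zero_of_lineModel (galAdicCompletionMap (L := L) (IsCMField.complexConj L) hw) (Matrix.diagonal dg) ιw φ' hφ's hφ'H hplane
  -- (B-2) THE WELD (★ p858068, F0P3-p01 (g33))
  have hlamΘ : lam * Θ lam = 1 := by rw [mul_comm]; exact hΘlam
  have hW := toricCensusSum_ramK_weld hρρ hvρ hΘρ hα1 hα hDΘ hρϖ hqM2 hσres hram hΘh hh hhyper hΘh' hh' haniso hlamΘ hu hu1' hm hjl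
    hd2 hjlS hmpar hmS (ε : ℚ) hεQ hside
  -- (B-5) THE H-SIDE: Eisenstein law at the descent (★ p857701 + class link), level `n_H = (jl − d)∕2`
  have h2w : Valued.v (2 : w.1.adicCompletion L) = Valued.v ϖ ^ tE := hD.2.2.2.2.2.2
  have hϖ1 : Valued.v ϖ < 1 := by rw [hϖ, ← WithZero.exp_zero, WithZero.exp_lt_exp]; norm_num
  have htr2 : Valued.v ((((γH.1.val : GL (Fin 2) (UnitaryGroup.LocalRing L v)).val.map
      (Pi.evalRingHom (fun w' : UnitaryGroup.PlacesOver L v => w'.1.adicCompletion L) w))).trace - 2) < Valued.v (2 : w.1.adicCompletion L) := by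
    refine hVtr.trans_lt ?_
    rw [map_mul]
    exact mul_lt_of_lt_one_right ((Valuation.pos_iff _).2 h20) hϖ1
  have htrv := valued_trace_eq_of_sub_two_lt htr2
  have hsq := sq_sub_map_eq_map_disc ιw hρlam hlam2
  have hmjl : m ≤ jl := by
    have hle : Valued.v ((lam - ιw u₀) - ρ' (lam - ιw u₀)) ≤ Valued.v (lam - ιw u₀) :=
      (Valuation.map_sub _ _ _).trans (max_le le_rfl (by rw [hvρ]))
    rw [hjl, hm, WithZero.exp_le_exp] at hle; omega
  have hΔv : Valued.v ((((γH.1.val : GL (Fin 2) (UnitaryGroup.LocalRing L v)).val.map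
      (Pi.evalRingHom (fun w' : UnitaryGroup.PlacesOver L v => w'.1.adicCompletion L) w))).trace ^ 2 -
      4 * (((γH.1.val : GL (Fin 2) (UnitaryGroup.LocalRing L v)).val.map
        (Pi.evalRingHom (fun w' : UnitaryGroup.PlacesOver L v => w'.1.adicCompletion L) w))).det) = WithZero.exp (-(2 * (jl : ℤ))) := by
    rw [← hjv1, ← hsq, map_pow, hjlv, ← WithZero.exp_nsmul, nsmul_eq_mul]; congr 1; ring
  have htube : Valued.v ((((γH.1.val : GL (Fin 2) (UnitaryGroup.LocalRing L v)).val.map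
      (Pi.evalRingHom (fun w' : UnitaryGroup.PlacesOver L v => w'.1.adicCompletion L) w))).trace ^ 2 -
      4 * (((γH.1.val : GL (Fin 2) (UnitaryGroup.LocalRing L v)).val.map
        (Pi.evalRingHom (fun w' : UnitaryGroup.PlacesOver L v => w'.1.adicCompletion L) w))).det) <
      Valued.v (4 : w.1.adicCompletion L) * Valued.v ϖ ^ 2 * Valued.v ((((γH.1.val : GL (Fin 2) (UnitaryGroup.LocalRing L v)).val.map
        (Pi.evalRingHom (fun w' : UnitaryGroup.PlacesOver L v => w'.1.adicCompletion L) w))).trace) ^ 2 := by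
    rw [hΔv, htrv, show (4 : w.1.adicCompletion L) = 2 ^ 2 by norm_num, map_pow, h2w, hϖ, ← pow_mul, ← pow_add, ← pow_add,
      ← WithZero.exp_nsmul, nsmul_eq_mul, mul_neg, mul_one, WithZero.exp_lt_exp]
    push_cast; omega
  haveI : Finite (IsLocalRing.ResidueField 𝒪[v.adicCompletion ↥(maximalRealSubfield L)]) :=
    finite_residueField_adicCompletion ↥(maximalRealSubfield L) v
  obtain ⟨αH, sH, g, uτ, wτ, z, n, dK, hαH, hvαH, hsH, hdesc, hz, hdisc, huτ, hdat, hdK, hlev⟩ :=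
    hSide_closedForm_of_tube_exists L v w hw (HeckeCharacter.valued_uniformizer v) he hD γH.1 hirr htube
  -- the inert branch is impossible on type B (Θ residually trivial) — (S-sel) ORGAN ★ LH4-p05 (g5) `F0P3cDyRamTypeBSelector.not_inertDatum_typeB_of_organ`
  have hσι : ∀ y, (galAdicCompletionMap (L := L) (IsCMField.complexConj L) hw) (toPlace v w y) = toPlace v w y :=
    fun y => galAdicCompletionMap_toPlace (IsCMField.complexConj L) w w hw y
  have hι2 : ∀ y, Valued.v (toPlace v w y) = Valued.v y ^ 2 :=
    fun y => valued_toPlace_eq_pow_two_of_ramified (IsCMField.complexConj L) w (IsCMField.complexConj_ne_one L) hw he y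
  have hαH0 : αH ≠ 0 := fun h0 => by
    rw [h0, map_zero] at hvαH
    rcases hvαH with h1 | h1
    · exact zero_ne_one h1
    · exact WithZero.zero_ne_coe h1
  have ht0 : (((γH.1.val : GL (Fin 2) (UnitaryGroup.LocalRing L v)).val.map
      (Pi.evalRingHom (fun w' : UnitaryGroup.PlacesOver L v => w'.1.adicCompletion L) w))).trace ≠ 0 := fun h0 => by
    rw [h0, map_zero] at htrv; exact h20 ((map_eq_zero _).1 htrv.symm)
  obtain ⟨-, hwτ1, hH⟩ := hdat.resolve_left (fun hin =>
    F0P3cDyRamTypeBSelector.not_inertDatum_typeB_of_organ (toPlace v w) hι2 _ hσι ιw hjv1 ρ' Θ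
      hjfix hΘj hΘres h20 hlam2 hρlam hΘlam hirr' ht0 rfl rfl hαH0 hsH hdesc hz hdisc huτ hin.1 hdK hin.2.2.1)
  -- the level link `jl = 2n + dK` (★ p858041) and the type-B exponent `dK = d`
  have hjl2n : jl = 2 * n + dK :=
    condLevel_eq_of_hlev ιw hjv1 hϖ hsq hjlv hlev htrv ((Valuation.ne_zero_iff _).2 h20)
  -- (S-dK) ORGAN ★ LH4-p05 (g5) `F0P3cDyRamTypeBSelector.discDepth_eq_typeB_of_organ` over ★ p858237 LH4-p12 (g5) `discDepth_eq_of_eisenstein`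
  have hdKd : dK = d :=
    F0P3cDyRamTypeBSelector.discDepth_eq_typeB_of_organ (toPlace v w) hι2 _ hσι ιw hjv1 ρ' Θ
      hρρ hvρ hjfix hΘj hΘΘ hΘρ h20 hDΘ hlam2 hρlam hΘlam hDσ ht0 rfl rfl hαH0 hsH hdesc (Matrix.GeneralLinearGroup.det_ne_zero g) hz hdisc
      (HeckeCharacter.valued_uniformizer v) hwτ1 hdK
  have hnjl : (jl - d) / 2 + 1 = n + 1 := by omega
  -- the closing arithmetic (★ p858013)
  have hq1 : 1 ≤ Fintype.card (Valued.ResidueField (w.1.adicCompletion L)) := Fintype.card_pos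
  have hweld : ((ε : ℤ) : ℚ) * ((((∑ j ∈ Finset.range (jl + 1), ∑ a ∈ Finset.range (jl + 2),
        qw ^ a * (levelSetDep ρ' Θ α (ιw ϖ) h j a (lam - ιw u₀)).ncard : ℕ) : ℚ)) -
      (((∑ j ∈ Finset.range (jl + 1), ∑ a ∈ Finset.range (jl + 2),
        qw ^ a * (levelSetDep ρ' Θ α (ιw ϖ) h' j a (lam - ιw u₀)).ncard : ℕ) : ℚ))) =
      (Fintype.card (Valued.ResidueField (w.1.adicCompletion L)) : ℚ) ^ m *
        (2 * ∑ i ∈ Finset.range ((jl - d) / 2 + 1), (Fintype.card (Valued.ResidueField (w.1.adicCompletion L)) : ℚ) ^ i -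
          2 * ∑ i ∈ Finset.range (d - d % 2), (Fintype.card (Valued.ResidueField (w.1.adicCompletion L)) : ℚ) ^ i) := by
    rw [← hqw]
    push_cast
    rw [← hW, ← Finset.sum_sub_distrib]
    congr 1
    refine Finset.sum_congr rfl fun j _ => ?_
    rw [← Finset.sum_sub_distrib]
    refine Finset.sum_congr rfl fun a _ => ?_
    ring
  rw [hA, hA', hqw]
  rw [hqw, hnjl] at hweld
  exact census_bottom_arith_eisenstein hε hweld hH hq1

end Summit.HodgeConjecture.HodgeConjecture.Cruxes.H413.F0P3cDyRamOrderCountCensusRamK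

end
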